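/-
Copyright (c) 2026 the pub-hodgecm-mathlib formalisation cell (harness21).  Prover seat hodgecm-mathlib-LH4-p11 (g3), req620 Track A «(D-RAM) FOUR-FRAME» squad
(dealer LH4-plan (g11) WORD #56 (b): (κ-B₂) payer «TYPE 2, UNSIGNED»; generic arithmetic piece «κ-BOX-SUM₂», the tv-2 twin of LH4-p14 (g3)'s «κ-BOX-SUM»).  2026-09-04.
-/
import Summits.HodgeConjecture.HodgeConjecture.Theorems.F0P3cDyRamKappaCountBoxSumTwoBlocks   -- FILE 1∕3 (this seat): blocks, telescoping, glue window
import HarnessLib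

/-!
# Crux `H413`, (D-RAM) FOUR-FRAME, U3 §K-R — «κ-BOX-SUM₂» FILE 2∕3: ONE PLANE AND THE DIAGONAL OF THE AXIS BOX, IN CLOSED FORM

Cell `hodgecm-mathlib` (D-0151), FLOOR 0, crux item H413 = `stmt-HodgeConjecture-24833`, route of record `HCCMUnconditional`; lane `--supports stmt-HodgeConjecture-24833 --as helper`
(count-neutral).  THEOREMS ONLY (no `def`, no instance, no notation, no `sorry`).  Pure finite-sum arithmetic over `ℚ` — no lattices, no fields.

THE ROAD («κ-BOX-SUM₂», three files).  The (κ-B₂) child `F0P3cDyRamFourFrameU3.stub_U3_kappaCount_typeTwo_mult` of tree U3 ED. 10 (:498) asks for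
`|Σᶠ_{M ∈ 𝓛₀(T), type-2-polarisable} κ_i(M)·w(M)| = ampl q k (B + τ d)∕4`.  After ★ `F0P3cDyRamStrataDecompositionGeneric` (LH4-p10 (g3)) the left side is a sum over the axis
box `a : Fin 3 → Fin (Bx+1)` of per-stratum sums `v a`, and these are the TYPE-2 κ-SOCKETS (on-branch ★ `F0P3cDyRamDiagonalKappaSplitCountTwoSockets`; glued: LH4-p09 (g3)
LETTER κB-G₂ v1 §4, typists F0P3-p01 (g31) ∕ LH4-p13 (g3); core-hanging: LH4-p06 (g3) LETTER κB-H₂ v1 §4, typists LH4-p07 (g5) ∕ LH4-p08 (g3)).  «κ-BOX-SUM₂» is the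
ARITHMETIC of that box sum with the socket right-hand sides as hypotheses and the K-dependent signs replaced by rational PARAMETERS (`ω` on the on-branch ∕ tube cells,
`εG p j` on the glue cells of foot `p`, `εH` on the equilateral core-hanging cells) — LH4-p14 (g3)'s frozen type-0 grammar (`sum_box_kappa_eq_typeZero`) with the type-2 tables:
`(q − 1)·Σ_{a ∈ box} v a = SIGN·(q^k − q^(k − B₂))`, `B₂ = (n_i + 4 − 2(d%2) − 3d)∕2 = B + tauOfRecord d`.  VALIDATED before typing by literal transcription
(`F0/P3c/LH4/LH4-p11/g3/kappa_boxsum_tv2_leanshape.v1.LH4p11g3.py` 997cfe04add05bbb: 2025 rows, 0 bad).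

THIS FILE (2∕3).  ★ `triple_sum_eq_diag_add_planes` (LH4-p04 (g2)) splits the box into the diagonal and three planes; here each piece of the TYPE-2 κ-table is evaluated:
* `plane_eval` — the plane of foot `p`, local letters (`n` = the foot's own depth, `μ′, μ″` the other two): the slot-own on-branch + tube cells (sign `θ`) telescope to
  `θ·(q^{⌊(n+1)∕2⌋ + ⌊(μ+1)∕2⌋} − q^{2⌊(μ+1)∕2⌋ + d − 1})` when the apex excess is `≥ 2d` (else `0`), the glue window of the foot gives `ε·(q^K − q^{K−C})`;
* `diag_eval` — the diagonal (equilateral core-hanging window, sign `εH`; no tube, no core at type 2).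
HONEST LABEL.  Count-neutral; nothing printed is asserted; (KMS) and its children stay PROVER TARGETS (empirical census laws in diagonal-model currency) until their payers land;
`HC_CM` is proved only modulo the 7 printed citations (2 remaining named inputs: hLiu418 = `stmt-HodgeConjecture-24832`, h413 = `stmt-HodgeConjecture-24833`) until rung 0 closes.

## References
* [Rogawski1990] J. D. Rogawski, *Automorphic Representations of Unitary Groups in Three Variables*, Ann. of Math. Stud. 123 (1990), §4.9 Prop. 4.9.1 (b) p. 55 (the κ-count).
* [Kottwitz1986BaseChangeUnits] R. E. Kottwitz, *Base change for unit elements of Hecke algebras*, Compositio Math. 60 (1986), §1 pp. 240–241.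
-/

set_option autoImplicit false

namespace Summit.HodgeConjecture.HodgeConjecture.Cruxes.H413.F0P3cDyRamKappaCountBoxSumTwoPlane

open Finset
open Summit.HodgeConjecture.HodgeConjecture.Cruxes.H413.F0P3cDyRamKappaCountBoxSumTwoBlocks

/-! ## §1  One plane of the box: on-branch + tubes (slot-own, sign `θ`) and the glue window of the foot (sign `ε`) -/

/-- **ONE PLANE (type-2 κ-table).**  Local letters: the plane's own depth `n`, the other two depths `μ′, μ″` (`μ = min μ′ μ″ ≤ n`, all `≡ d (mod 2)`, `2 ≤ d ≤` each);
`φ r t` = the weight of the axis vector with `r` on the plane's own coordinate and `t` on the two others.  If `φ` follows the type-2 κ-table — on-branch row `r = 0`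
(slot-own only: `θ·q^{⌊s∕2⌋}` at odd `s ≥ 2d−1`, `s ≤ n`), glued rows `r = 2ρ+1` (slot-own tube `θ·q^{2ρ+s∕2}((q−1)[2d ≤ s] − [s+2 = 2d])` + the foot's glue shell with
bracket-guarded sign `ε`), zero rows `r` even `≥ 2` — then `(q−1)·Σ_{r<t} φ r t` = the slot-own telescoped block (alive iff `μ + 2d ≤ n`) + `ε·(q^K − q^{K−C})` on the glue
window (`K = μ′ + (n−μ′)∕2 + (μ′−d)∕2 + 1`, `C = (μ′−d)∕2 + 2 − d%2 − c₀`, `c₀ = max 1 ((2d − (n−μ′))∕2)` slot-own, `d` otherwise). [folklore] -/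
theorem plane_eval (q : ℚ) {d n μ' μ'' B : ℕ} (hd : 2 ≤ d) (hdμ : d ≤ min μ' μ'')
    (hpn : n % 2 = d % 2) (hp' : μ' % 2 = d % 2) (hp'' : μ'' % 2 = d % 2) (hB : n + μ' + μ'' ≤ B)
    (θ ε : ℚ) (own : Prop) [Decidable own] (φ : ℕ → ℕ → ℚ)
    (hT : ∀ s, 1 ≤ s → φ 0 s = if own ∧ 2 * d ≤ s + 1 ∧ ¬ 2 ∣ s ∧ s ≤ n then θ * q ^ (s / 2) else 0)
    (hG : ∀ ρ s, 1 ≤ s → φ (2 * ρ + 1) (2 * ρ + 1 + s) =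
      (if 2 ∣ s ∧ 2 * ρ + 1 ≤ min μ' μ'' ∧ 2 * ρ + 1 + s ≤ n then
          (if own then θ * q ^ (2 * ρ + s / 2) * ((if 2 * d ≤ s then q - 1 else 0) - (if s + 2 = 2 * d then 1 else 0)) else 0) else 0) +
      (if 2 ∣ s ∧ μ' = μ'' ∧ n = μ' + s ∧ μ' < 2 * ρ + 1 ∧ 2 * ρ + 1 ≤ 2 * μ' ∧ 2 * ρ + 1 - μ' ≤ μ' - d + 1 then
          (if own then (if 2 * d ≤ s + 2 * ((2 * ρ + 1 - μ' + 1) / 2) then ε else 0) else (if d ≤ (2 * ρ + 1 - μ' + 1) / 2 then ε else 0)) *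
            q ^ (2 * ρ + s / 2 + 1 - (2 * ρ + 1 - μ' + 1) / 2) else 0))
    (hZ : ∀ ρ s, 1 ≤ s → φ (2 * ρ + 2) (2 * ρ + 2 + s) = 0) :
    (q - 1) * ∑ r ∈ range (B + 1), ∑ t ∈ range (B + 1), (if r < t then φ r t else 0) =
      (if own then θ * (if min μ' μ'' + 2 * d ≤ n then
          q ^ ((n + 1) / 2 + (min μ' μ'' + 1) / 2) - q ^ (2 * ((min μ' μ'' + 1) / 2) + d - 1) else 0) else 0) +
      ε * (if μ' = μ'' ∧ μ' < n then
          q ^ (μ' + (n - μ') / 2 + (μ' - d) / 2 + 1) -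
            q ^ (μ' + (n - μ') / 2 + (μ' - d) / 2 + 1 - ((μ' - d) / 2 + 2 - d % 2 - (if own then max 1 ((2 * d - (n - μ')) / 2) else d)))
        else 0) := by
  set μ := min μ' μ'' with hμ_def
  have hμle' : μ ≤ μ' := min_le_left _ _
  have hμle'' : μ ≤ μ'' := min_le_right _ _
  have hμor : μ = μ' ∨ μ = μ'' := min_choice _ _
  have hμpar : μ % 2 = d % 2 := by rcases hμor with h | h <;> omega
  set c₀ : ℕ := (if own then max 1 ((2 * d - (n - μ')) / 2) else d) with hc₀_def
  have hc₀ : 1 ≤ c₀ := by rw [hc₀_def]; split_ifs <;> omega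
  -- the bracket of the glue cell at row `r`, as a threshold on `c = ⌈(r−μ′)∕2⌉`
  have hbrk : ∀ r s, μ' < r → n = μ' + s →
      ((if own then (if 2 * d ≤ s + 2 * ((r - μ' + 1) / 2) then ε else 0) else (if d ≤ (r - μ' + 1) / 2 then ε else 0)) =
        if c₀ ≤ (r - μ' + 1) / 2 then ε else 0) := by
    intro r s hr hs
    rw [hc₀_def]
    by_cases ho : own
    · simp only [if_pos ho]
      by_cases h : 2 * d ≤ s + 2 * ((r - μ' + 1) / 2)
      · rw [if_pos h, if_pos (by omega)]
      · rw [if_neg h, if_neg (by omega)]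
    · simp only [if_neg ho]
  -- ROW BY ROW
  have hrow : ∀ r ∈ range (B + 1), ∑ t ∈ range (B + 1), (if r < t then φ r t else 0) =
      (if r = 0 then (if own then θ * ∑ j ∈ Ico (d - 1) ((n + 1) / 2), q ^ j else 0) else 0) +
      (if 1 ≤ r ∧ ¬ 2 ∣ r ∧ r ≤ μ then
          (if own then θ * ((q ^ (max (r - 1 + d) (r + (n - r) / 2)) - q ^ (r - 1 + d)) - (if r + 2 * d - 2 ≤ n then q ^ (r + d - 2) else 0)) else 0)
        else 0) +
      (if ¬ 2 ∣ r ∧ μ' < r ∧ r ≤ 2 * μ' ∧ r - μ' ≤ μ' - d + 1 ∧ c₀ ≤ (r - μ' + 1) / 2 then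
          (if μ' = μ'' ∧ μ' < n then ε * q ^ (r + (n - μ') / 2 - (r - μ' + 1) / 2) else 0) else 0) := by
    intro r hr
    rw [mem_range] at hr
    rcases Nat.eq_zero_or_pos r with rfl | hrpos
    · -- the on-branch row
      have h1 : ¬ (1 ≤ 0 ∧ ¬ 2 ∣ 0 ∧ 0 ≤ μ) := fun h => absurd h.1 (by omega)
      have h2 : ¬ (¬ 2 ∣ 0 ∧ μ' < 0 ∧ 0 ≤ 2 * μ' ∧ 0 - μ' ≤ μ' - d + 1 ∧ c₀ ≤ (0 - μ' + 1) / 2) := fun h => absurd h.2.1 (by omega)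
      rw [if_pos rfl, if_neg h1, if_neg h2, add_zero, add_zero]
      have hsum : ∑ t ∈ range (B + 1), (if 0 < t then φ 0 t else 0) =
          ∑ t ∈ range (B + 1), (if own then (if 1 ≤ t ∧ 2 * d ≤ t + 1 ∧ ¬ 2 ∣ t ∧ t ≤ n then θ * q ^ (t / 2) else 0) else 0) := by
        refine sum_congr rfl fun t _ => ?_
        rcases Nat.eq_zero_or_pos t with rfl | htpos
        · have h3 : ¬ (1 ≤ 0 ∧ 2 * d ≤ 0 + 1 ∧ ¬ 2 ∣ 0 ∧ 0 ≤ n) := fun h => absurd h.1 (by omega)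
          rw [if_neg (lt_irrefl 0), if_neg h3, ite_self]
        · rw [if_pos htpos, hT t htpos]
          by_cases ho : own
          · by_cases h : 2 * d ≤ t + 1 ∧ ¬ 2 ∣ t ∧ t ≤ n
            · have h4 : own ∧ 2 * d ≤ t + 1 ∧ ¬ 2 ∣ t ∧ t ≤ n := ⟨ho, h⟩
              have h5 : 1 ≤ t ∧ 2 * d ≤ t + 1 ∧ ¬ 2 ∣ t ∧ t ≤ n := ⟨htpos, h⟩
              rw [if_pos h4, if_pos ho, if_pos h5]
            · have h4 : ¬ (own ∧ 2 * d ≤ t + 1 ∧ ¬ 2 ∣ t ∧ t ≤ n) := fun h' => h h'.2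
              have h5 : ¬ (1 ≤ t ∧ 2 * d ≤ t + 1 ∧ ¬ 2 ∣ t ∧ t ≤ n) := fun h' => h h'.2
              rw [if_neg h4, if_pos ho, if_neg h5]
          · have h4 : ¬ (own ∧ 2 * d ≤ t + 1 ∧ ¬ 2 ∣ t ∧ t ≤ n) := fun h' => ho h'.1
            rw [if_neg h4, if_neg ho]
      rw [hsum]
      by_cases ho : own
      · simp only [if_pos ho]
        rw [← onBranch_block q (by omega : 1 ≤ d) (by omega : n ≤ B), mul_sum]
        refine sum_congr rfl fun t _ => ?_
        split_ifs <;> simp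
      · simp only [if_neg ho]
        exact sum_const_zero
    · rw [if_neg (show (r : ℕ) ≠ 0 by omega), zero_add]
      by_cases hodd : 2 ∣ r
      · -- even row `≥ 2`: everything vanishes
        obtain ⟨ρ, rfl⟩ : ∃ ρ, r = 2 * ρ + 2 := ⟨r / 2 - 1, by omega⟩
        have h1 : ¬ (1 ≤ 2 * ρ + 2 ∧ ¬ 2 ∣ (2 * ρ + 2) ∧ 2 * ρ + 2 ≤ μ) := fun h => h.2.1 hodd
        have h2 : ¬ (¬ 2 ∣ (2 * ρ + 2) ∧ μ' < 2 * ρ + 2 ∧ 2 * ρ + 2 ≤ 2 * μ' ∧ 2 * ρ + 2 - μ' ≤ μ' - d + 1 ∧ c₀ ≤ (2 * ρ + 2 - μ' + 1) / 2) :=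
          fun h => h.1 hodd
        rw [if_neg h1, if_neg h2, add_zero]
        refine sum_eq_zero fun t _ => ?_
        by_cases hrt : 2 * ρ + 2 < t
        · rw [if_pos hrt, show t = 2 * ρ + 2 + (t - (2 * ρ + 2)) by omega, hZ ρ _ (by omega)]
        · rw [if_neg hrt]
      · -- odd row `r = 2ρ + 1`
        obtain ⟨ρ, rfl⟩ : ∃ ρ, r = 2 * ρ + 1 := ⟨r / 2, by omega⟩
        have hsum : ∑ t ∈ range (B + 1), (if 2 * ρ + 1 < t then φ (2 * ρ + 1) t else 0) =
            ∑ t ∈ range (B + 1),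
              ((if own ∧ 2 * ρ + 1 ≤ μ then
                  (if 2 * ρ + 1 < t ∧ 2 ∣ (t - (2 * ρ + 1)) ∧ t ≤ n then
                    θ * (q ^ (2 * ρ + 1 - 1 + (t - (2 * ρ + 1)) / 2) *
                      ((if 2 * d ≤ t - (2 * ρ + 1) then q - 1 else 0) - (if t - (2 * ρ + 1) + 2 = 2 * d then 1 else 0))) else 0)
                else 0) +
              (if 2 * ρ + 1 < t ∧ 2 ∣ (t - (2 * ρ + 1)) ∧ μ' = μ'' ∧ n = μ' + (t - (2 * ρ + 1)) ∧ μ' < 2 * ρ + 1 ∧ 2 * ρ + 1 ≤ 2 * μ' ∧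
                    2 * ρ + 1 - μ' ≤ μ' - d + 1 ∧ c₀ ≤ (2 * ρ + 1 - μ' + 1) / 2 then
                  ε * q ^ (2 * ρ + (t - (2 * ρ + 1)) / 2 + 1 - (2 * ρ + 1 - μ' + 1) / 2) else 0)) := by
          refine sum_congr rfl fun t _ => ?_
          rw [Nat.add_sub_cancel]
          by_cases hrt : 2 * ρ + 1 < t
          · obtain ⟨s, rfl⟩ : ∃ s, t = 2 * ρ + 1 + s := ⟨t - (2 * ρ + 1), by omega⟩
            rw [if_pos hrt, hG ρ s (by omega), Nat.add_sub_cancel_left]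
            congr 1
            · -- tube cell
              by_cases ho : own
              · by_cases hc : 2 ∣ s ∧ 2 * ρ + 1 ≤ μ ∧ 2 * ρ + 1 + s ≤ n
                · have hC1 : own ∧ 2 * ρ + 1 ≤ μ := ⟨ho, hc.2.1⟩
                  have hC2 : 2 * ρ + 1 < 2 * ρ + 1 + s ∧ 2 ∣ s ∧ 2 * ρ + 1 + s ≤ n := ⟨hrt, hc.1, hc.2.2⟩
                  rw [if_pos hc, if_pos ho, if_pos hC1, if_pos hC2]; ring
                · rw [if_neg hc]
                  by_cases hm : 2 * ρ + 1 ≤ μ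
                  · have hC1 : own ∧ 2 * ρ + 1 ≤ μ := ⟨ho, hm⟩
                    have hC2 : ¬ (2 * ρ + 1 < 2 * ρ + 1 + s ∧ 2 ∣ s ∧ 2 * ρ + 1 + s ≤ n) := fun h => hc ⟨h.2.1, hm, h.2.2⟩
                    rw [if_pos hC1, if_neg hC2]
                  · have hC1 : ¬ (own ∧ 2 * ρ + 1 ≤ μ) := fun h => hm h.2
                    rw [if_neg hC1]
              · have hC1 : ¬ (own ∧ 2 * ρ + 1 ≤ μ) := fun h => ho h.1
                rw [if_neg hC1]
                by_cases hc : 2 ∣ s ∧ 2 * ρ + 1 ≤ μ ∧ 2 * ρ + 1 + s ≤ n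
                · rw [if_pos hc, if_neg ho]
                · rw [if_neg hc]
            · -- glue cell
              by_cases hc : 2 ∣ s ∧ μ' = μ'' ∧ n = μ' + s ∧ μ' < 2 * ρ + 1 ∧ 2 * ρ + 1 ≤ 2 * μ' ∧ 2 * ρ + 1 - μ' ≤ μ' - d + 1
              · rw [if_pos hc, hbrk (2 * ρ + 1) s hc.2.2.2.1 hc.2.2.1]
                by_cases hb : c₀ ≤ (2 * ρ + 1 - μ' + 1) / 2
                · have hC : 2 * ρ + 1 < 2 * ρ + 1 + s ∧ 2 ∣ s ∧ μ' = μ'' ∧ n = μ' + s ∧ μ' < 2 * ρ + 1 ∧ 2 * ρ + 1 ≤ 2 * μ' ∧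
                      2 * ρ + 1 - μ' ≤ μ' - d + 1 ∧ c₀ ≤ (2 * ρ + 1 - μ' + 1) / 2 :=
                    ⟨hrt, hc.1, hc.2.1, hc.2.2.1, hc.2.2.2.1, hc.2.2.2.2.1, hc.2.2.2.2.2, hb⟩
                  rw [if_pos hb, if_pos hC]
                · have hC : ¬ (2 * ρ + 1 < 2 * ρ + 1 + s ∧ 2 ∣ s ∧ μ' = μ'' ∧ n = μ' + s ∧ μ' < 2 * ρ + 1 ∧
                      2 * ρ + 1 ≤ 2 * μ' ∧ 2 * ρ + 1 - μ' ≤ μ' - d + 1 ∧ c₀ ≤ (2 * ρ + 1 - μ' + 1) / 2) := fun h => hb h.2.2.2.2.2.2.2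
                  rw [if_neg hb, if_neg hC, zero_mul]
              · have hC : ¬ (2 * ρ + 1 < 2 * ρ + 1 + s ∧ 2 ∣ s ∧ μ' = μ'' ∧ n = μ' + s ∧ μ' < 2 * ρ + 1 ∧
                    2 * ρ + 1 ≤ 2 * μ' ∧ 2 * ρ + 1 - μ' ≤ μ' - d + 1 ∧ c₀ ≤ (2 * ρ + 1 - μ' + 1) / 2) :=
                  fun h => hc ⟨h.2.1, h.2.2.1, h.2.2.2.1, h.2.2.2.2.1, h.2.2.2.2.2.1, h.2.2.2.2.2.2.1⟩
                rw [if_neg hc, if_neg hC]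
          · have hC2 : ¬ (2 * ρ + 1 < t ∧ 2 ∣ (t - (2 * ρ + 1)) ∧ t ≤ n) := fun h => hrt h.1
            have hC : ¬ (2 * ρ + 1 < t ∧ 2 ∣ (t - (2 * ρ + 1)) ∧ μ' = μ'' ∧ n = μ' + (t - (2 * ρ + 1)) ∧ μ' < 2 * ρ + 1 ∧
                2 * ρ + 1 ≤ 2 * μ' ∧ 2 * ρ + 1 - μ' ≤ μ' - d + 1 ∧ c₀ ≤ (2 * ρ + 1 - μ' + 1) / 2) := fun h => hrt h.1
            rw [if_neg hrt, if_neg hC2, if_neg hC, ite_self, add_zero]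
        rw [hsum, sum_add_distrib]
        congr 1
        · -- the tube row
          by_cases hom : own ∧ 2 * ρ + 1 ≤ μ
          · have hC : 1 ≤ 2 * ρ + 1 ∧ ¬ 2 ∣ (2 * ρ + 1) ∧ 2 * ρ + 1 ≤ μ := ⟨by omega, hodd, hom.2⟩
            simp only [if_pos hom]
            rw [if_pos hC, if_pos hom.1, ← tube_row q hd (by omega : n ≤ B) (2 * ρ + 1) (by omega), mul_sum]
            refine sum_congr rfl fun t _ => ?_
            split_ifs <;> ring
          · simp only [if_neg hom]
            rw [sum_const_zero]
            by_cases ho : own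
            · have hC : ¬ (1 ≤ 2 * ρ + 1 ∧ ¬ 2 ∣ (2 * ρ + 1) ∧ 2 * ρ + 1 ≤ μ) := fun h => hom ⟨ho, h.2.2⟩
              rw [if_neg hC]
            · split_ifs <;> rfl
        · -- the glue cell of this row
          rw [sum_range_ite_single _ _ (2 * ρ + 1 + (n - μ')) (fun t ht => by omega)]
          by_cases hc : ¬ 2 ∣ (2 * ρ + 1) ∧ μ' < 2 * ρ + 1 ∧ 2 * ρ + 1 ≤ 2 * μ' ∧ 2 * ρ + 1 - μ' ≤ μ' - d + 1 ∧ c₀ ≤ (2 * ρ + 1 - μ' + 1) / 2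
          · rw [if_pos hc]
            by_cases hap : μ' = μ'' ∧ μ' < n
            · have hC : (2 * ρ + 1 < 2 * ρ + 1 + (n - μ') ∧ 2 ∣ (2 * ρ + 1 + (n - μ') - (2 * ρ + 1)) ∧ μ' = μ'' ∧
                  n = μ' + (2 * ρ + 1 + (n - μ') - (2 * ρ + 1)) ∧ μ' < 2 * ρ + 1 ∧ 2 * ρ + 1 ≤ 2 * μ' ∧ 2 * ρ + 1 - μ' ≤ μ' - d + 1 ∧
                  c₀ ≤ (2 * ρ + 1 - μ' + 1) / 2) ∧ 2 * ρ + 1 + (n - μ') ≤ B :=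
                ⟨⟨by omega, by omega, hap.1, by omega, hc.2.1, hc.2.2.1, hc.2.2.2.1, hc.2.2.2.2⟩, by omega⟩
              rw [if_pos hap, if_pos hC, show 2 * ρ + (2 * ρ + 1 + (n - μ') - (2 * ρ + 1)) / 2 + 1 = 2 * ρ + 1 + (n - μ') / 2 by omega]
            · rw [if_neg hap, if_neg]
              rintro ⟨⟨h1, -, h3, h4, -⟩, -⟩
              exact hap ⟨h3, by omega⟩
          · rw [if_neg hc, if_neg]
            rintro ⟨⟨-, -, -, -, h5, h6, h7, h8⟩, -⟩
            exact hc ⟨hodd, h5, h6, h7, h8⟩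
  -- SUM THE ROWS
  rw [sum_congr rfl hrow, sum_add_distrib, sum_add_distrib]
  rw [sum_range_ite_single (fun r => r = 0) _ 0 (fun r h => h), if_pos ⟨rfl, Nat.zero_le _⟩]
  -- the tube block
  have htube : ∑ r ∈ range (B + 1), (if 1 ≤ r ∧ ¬ 2 ∣ r ∧ r ≤ μ then
      (if own then θ * ((q ^ (max (r - 1 + d) (r + (n - r) / 2)) - q ^ (r - 1 + d)) - (if r + 2 * d - 2 ≤ n then q ^ (r + d - 2) else 0)) else 0)
      else 0) =
      if own then θ * ∑ ρ ∈ range ((μ + 1) / 2), ((if d + ρ + 1 ≤ (n + 1) / 2 then q ^ (ρ + (n + 1) / 2) - q ^ (2 * ρ + d) else 0) -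
        (if d + ρ ≤ (n + 1) / 2 then q ^ (2 * ρ + d - 1) else 0)) else 0 := by
    by_cases ho : own
    · simp only [if_pos ho]
      rw [← tube_block q (by omega : 1 ≤ d) (by omega : μ ≤ B), mul_sum]
      refine sum_congr rfl fun r _ => ?_
      split_ifs <;> ring
    · simp only [if_neg ho]
      exact sum_eq_zero fun r _ => by split_ifs <;> rfl
  -- the glue window
  have hglue : ∑ r ∈ range (B + 1), (if ¬ 2 ∣ r ∧ μ' < r ∧ r ≤ 2 * μ' ∧ r - μ' ≤ μ' - d + 1 ∧ c₀ ≤ (r - μ' + 1) / 2 then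
      (if μ' = μ'' ∧ μ' < n then ε * q ^ (r + (n - μ') / 2 - (r - μ' + 1) / 2) else 0) else 0) =
      if μ' = μ'' ∧ μ' < n then ε * ∑ j ∈ Ico (μ' + (n - μ') / 2 + (μ' - d) / 2 + 1 - ((μ' - d) / 2 + 2 - d % 2 - c₀))
        (μ' + (n - μ') / 2 + (μ' - d) / 2 + 1), q ^ j else 0 := by
    by_cases hap : μ' = μ'' ∧ μ' < n
    · simp only [if_pos hap]
      rw [← glue_window q (by omega : 1 ≤ d) (by omega : d ≤ μ') hp' (show 2 ∣ (n - μ') by omega) hc₀ (by omega : 2 * μ' ≤ B), mul_sum]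
      refine sum_congr rfl fun r _ => ?_
      split_ifs <;> ring
    · simp only [if_neg hap]
      exact sum_eq_zero fun r _ => by split_ifs <;> rfl
  rw [htube, hglue]
  -- ASSEMBLE
  have e1 : (q - 1) * (∑ j ∈ Ico (d - 1) ((n + 1) / 2), q ^ j + ∑ ρ ∈ range ((μ + 1) / 2),
      ((if d + ρ + 1 ≤ (n + 1) / 2 then q ^ (ρ + (n + 1) / 2) - q ^ (2 * ρ + d) else 0) - (if d + ρ ≤ (n + 1) / 2 then q ^ (2 * ρ + d - 1) else 0))) =
      (if μ + 2 * d ≤ n then q ^ ((n + 1) / 2 + (μ + 1) / 2) - q ^ (2 * ((μ + 1) / 2) + d - 1) else 0) := by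
    rw [telescope q (by omega : 1 ≤ d) ((n + 1) / 2) ((μ + 1) / 2), mul_sum_Ico_pow']
    by_cases hal : μ + 2 * d ≤ n
    · rw [if_pos hal, max_eq_right (by omega)]
    · rw [if_neg hal, max_eq_left (by omega), sub_self]
  have e2 : (q - 1) * ∑ j ∈ Ico (μ' + (n - μ') / 2 + (μ' - d) / 2 + 1 - ((μ' - d) / 2 + 2 - d % 2 - c₀)) (μ' + (n - μ') / 2 + (μ' - d) / 2 + 1), q ^ j =
      q ^ (μ' + (n - μ') / 2 + (μ' - d) / 2 + 1) - q ^ (μ' + (n - μ') / 2 + (μ' - d) / 2 + 1 - ((μ' - d) / 2 + 2 - d % 2 - c₀)) :=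
    mul_sum_Ico_pow q (Nat.sub_le _ _)
  by_cases ho : own
  · simp only [if_pos ho]
    by_cases hap : μ' = μ'' ∧ μ' < n
    · simp only [if_pos hap]
      linear_combination θ * e1 + ε * e2
    · simp only [if_neg hap]
      linear_combination θ * e1
  · simp only [if_neg ho]
    by_cases hap : μ' = μ'' ∧ μ' < n
    · simp only [if_pos hap]
      linear_combination ε * e2
    · simp only [if_neg hap]
      ring

/-! ## §2  The diagonal: the equilateral core-hanging glue window (sign `εH`), no tube, no core -/

/-- **THE DIAGONAL (type-2 κ-table).**  `ψ r` = the weight of `(r,r,r)`: zero at `r = 0` and at even `r`, the bracket-guarded equilateral glue shell `εH·q^{r − ⌈(r−n₁)∕2⌉}` at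
odd `r` in the window; then `(q−1)·Σ_r ψ r = [n₁ = n₂ = n₃]·εH·(q^K − q^{K−C})` with `K = n₁ + (n₁−d)∕2 + 1`, `C = (n₁−d)∕2 + 2 − d%2 − d` (§4 at excess `0`, threshold `d`).
[folklore] -/
theorem diag_eval (q : ℚ) {d n₁ n₂ n₃ B : ℕ} (hd : 2 ≤ d) (hdn : d ≤ n₁) (hp1 : n₁ % 2 = d % 2) (hB : n₁ + n₂ + n₃ ≤ B) (εH : ℚ) (ψ : ℕ → ℚ)
    (h0 : ψ 0 = 0)
    (hH : ∀ ρ, ψ (2 * ρ + 1) =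
      if n₁ = n₂ ∧ n₂ = n₃ ∧ n₁ < 2 * ρ + 1 ∧ 2 * ρ + 1 ≤ 2 * n₁ ∧ 2 * ρ + 1 - n₁ ≤ n₁ - d + 1 ∧ d ≤ (2 * ρ + 1 - n₁ + 1) / 2
      then εH * q ^ (2 * ρ + 1 - (2 * ρ + 1 - n₁ + 1) / 2) else 0)
    (hZ : ∀ ρ, ψ (2 * ρ + 2) = 0) :
    (q - 1) * ∑ r ∈ range (B + 1), ψ r =
      if n₁ = n₂ ∧ n₂ = n₃ then εH * (q ^ (n₁ + 0 / 2 + (n₁ - d) / 2 + 1) - q ^ (n₁ + 0 / 2 + (n₁ - d) / 2 + 1 - ((n₁ - d) / 2 + 2 - d % 2 - d))) else 0 := by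
  have hrow : ∀ r ∈ range (B + 1), ψ r =
      if ¬ 2 ∣ r ∧ n₁ < r ∧ r ≤ 2 * n₁ ∧ r - n₁ ≤ n₁ - d + 1 ∧ d ≤ (r - n₁ + 1) / 2 then
        (if n₁ = n₂ ∧ n₂ = n₃ then εH * q ^ (r + 0 / 2 - (r - n₁ + 1) / 2) else 0) else 0 := by
    intro r _
    rcases Nat.eq_zero_or_pos r with rfl | hrpos
    · have h1 : ¬ (¬ 2 ∣ 0 ∧ n₁ < 0 ∧ 0 ≤ 2 * n₁ ∧ 0 - n₁ ≤ n₁ - d + 1 ∧ d ≤ (0 - n₁ + 1) / 2) := fun h => absurd h.2.1 (by omega)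
      rw [h0, if_neg h1]
    · by_cases hodd : 2 ∣ r
      · obtain ⟨ρ, rfl⟩ : ∃ ρ, r = 2 * ρ + 2 := ⟨r / 2 - 1, by omega⟩
        have h1 : ¬ (¬ 2 ∣ (2 * ρ + 2) ∧ n₁ < 2 * ρ + 2 ∧ 2 * ρ + 2 ≤ 2 * n₁ ∧ 2 * ρ + 2 - n₁ ≤ n₁ - d + 1 ∧ d ≤ (2 * ρ + 2 - n₁ + 1) / 2) :=
          fun h => h.1 hodd
        rw [hZ ρ, if_neg h1]
      · obtain ⟨ρ, rfl⟩ : ∃ ρ, r = 2 * ρ + 1 := ⟨r / 2, by omega⟩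
        rw [hH ρ, Nat.zero_div, Nat.add_zero]
        by_cases he : n₁ = n₂ ∧ n₂ = n₃
        · by_cases hw : n₁ < 2 * ρ + 1 ∧ 2 * ρ + 1 ≤ 2 * n₁ ∧ 2 * ρ + 1 - n₁ ≤ n₁ - d + 1 ∧ d ≤ (2 * ρ + 1 - n₁ + 1) / 2
          · have h1 : ¬ 2 ∣ (2 * ρ + 1) ∧ n₁ < 2 * ρ + 1 ∧ 2 * ρ + 1 ≤ 2 * n₁ ∧ 2 * ρ + 1 - n₁ ≤ n₁ - d + 1 ∧ d ≤ (2 * ρ + 1 - n₁ + 1) / 2 :=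
              ⟨hodd, hw⟩
            rw [if_pos ⟨he.1, he.2, hw⟩, if_pos h1, if_pos he]
          · have h1 : ¬ (¬ 2 ∣ (2 * ρ + 1) ∧ n₁ < 2 * ρ + 1 ∧ 2 * ρ + 1 ≤ 2 * n₁ ∧ 2 * ρ + 1 - n₁ ≤ n₁ - d + 1 ∧ d ≤ (2 * ρ + 1 - n₁ + 1) / 2) :=
              fun h => hw h.2
            have h2 : ¬ (n₁ = n₂ ∧ n₂ = n₃ ∧ n₁ < 2 * ρ + 1 ∧ 2 * ρ + 1 ≤ 2 * n₁ ∧ 2 * ρ + 1 - n₁ ≤ n₁ - d + 1 ∧ d ≤ (2 * ρ + 1 - n₁ + 1) / 2) :=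
              fun h => hw h.2.2
            rw [if_neg h2, if_neg h1]
        · have h2 : ¬ (n₁ = n₂ ∧ n₂ = n₃ ∧ n₁ < 2 * ρ + 1 ∧ 2 * ρ + 1 ≤ 2 * n₁ ∧ 2 * ρ + 1 - n₁ ≤ n₁ - d + 1 ∧ d ≤ (2 * ρ + 1 - n₁ + 1) / 2) :=
            fun h => he ⟨h.1, h.2.1⟩
          rw [if_neg h2, if_neg he, ite_self]
  rw [sum_congr rfl hrow]
  by_cases he : n₁ = n₂ ∧ n₂ = n₃
  · simp only [if_pos he]
    rw [← mul_sum_Ico_pow q (Nat.sub_le _ _), ← glue_window q (B := B) (by omega : 1 ≤ d) hdn hp1 (dvd_zero 2) (by omega : 1 ≤ d) (by omega : 2 * n₁ ≤ B),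
      mul_sum, mul_sum, mul_sum]
    refine sum_congr rfl fun r _ => ?_
    split_ifs <;> ring
  · simp only [if_neg he, ite_self, sum_const_zero, mul_zero]

end Summit.HodgeConjecture.HodgeConjecture.Cruxes.H413.F0P3cDyRamKappaCountBoxSumTwoPlane
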